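import Summits.QuantumFields.YangMills.Theorems.ParabolicTrajectoryContinuumLimitOnTrajectoryDefsC
import Summits.QuantumFields.YangMills.Theorems.ParabolicTrajectoryContinuumLimitOnTrajectoryUclSlab
import Summits.QuantumFields.YangMills.Theorems.ParabolicTrajectoryContinuumLimitOnTrajectoryUclRot
import Literature.MathematicalPhysics.QuantumLattice.SchwartzHalfSpaceCutoff

/-!
# Crux `ContinuumLimitOnTrajectory` (stmt-QuantumFields-10522), line `two-orbit-synchronisation` (seat c2):
# shared vocabulary of the clustering leg (`stub_uclOfGap`), wave 2

Route-posited helper vocabulary (same namespace as `…Defs/…DefsB/…DefsC`) fixing, for the three wave-2 helper theorems of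
`stub_uclOfGap : UCLOfGap` and for the lead's assembly, the EXACT statements they share. Nothing is asserted.

* `planeRefl k T` — the torus reflection about the lattice time plane `T` (`τ_{−T} ∘ Θ' ∘ τ_T`);
* `VarBound r sch` — the OS-variance input of the main term: the reflected self-pairing of the lattice observable of a windowed,
  locus-avoiding test function across a time plane at distance ≥ `R₀ + 2` lattice units from its window is bounded, uniformly in `k`
  (beyond a threshold), by `C (1 + |a_k T|)^κ |Φ'|²_{s''}` (proved from `UUVB` by the reflection identity + plaquette-string expansion);
* `rhoK sch k = √(a_k L_k)` — the `k`-dependent far-window radius (→ ∞, and `≤ a_k L_k / 16` eventually);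
* `lowMain/lowMid/lowFar`, `upMain/upMid/upFar` — the three-piece decompositions of the lower factor and of the translated upper factor by
  the half-space cutoffs `cutLE 0`, `cutGE 0` of `SchwartzHalfSpaceCutoff` (window `[−ρ_k, s₀/4]`, resp. `[3s₀/4, s₀ + ρ_k]`, `s₀ = t·b₀`);
* `CoreClustering r sch` — the core estimate the assembly reduces `UCL` to (locus-avoiding factors separated by a spatial coordinate,
  translation with positive time component and vanishing separating component).
-/

set_option autoImplicit false

open scoped SchwartzMap ComplexConjugate
open MeasureTheory Filter Topology Set
open Literature.MathematicalPhysics.QuantumFieldTheory Literature.MathematicalPhysics.QuantumLattice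
open Literature.MathematicalPhysics.AQFT Literature.Probability.LatticeModels

noncomputable section

namespace Summit.QuantumFields.YangMills.Cruxes.ContinuumLimitOnTrajectory.TwoOrbitSynchronisation

local notation "𝔼" => EuclideanSpace ℝ (Fin 4)

variable {G : Type} [Group G] [TopologicalSpace G] [IsTopologicalGroup G] [CompactSpace G]
  [MeasurableSpace G] [BorelSpace G]

/-- **Reflection of the torus about the lattice time plane `T`**: `τ_{−T} ∘ Θ' ∘ τ_T` (`Θ' = negReflect` reflects about `0`). An observable
reading the times `[lo, hi]` composed with it reads `[2T − hi − 1, 2T − lo]` (`ReadsTimes.comp_timeShiftInt/comp_negReflect`). -/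
def planeRefl (sch : SpeciesScheme (YMSpecies G)) (k : ℕ) (T : ℤ) (U : GaugeConfig 4 (sch.side k) G) : GaugeConfig 4 (sch.side k) G :=
  timeShiftInt (sch.side k) (-T) (timeShiftInt (sch.side k) T U).negReflect

/-- **The OS-variance input of the main term** (proved from `UUVB` in `…UclVar*`): for every arity `p` there are a Schwartz index `s''`,
an exponent `κ`, a constant `C ≥ 0` and ONE threshold in `k` beyond which, for every locus-avoiding `p`-point test function `Φ'` whose
points all have physical times in `[θlo, θhi]`, every lattice time plane `T` at least `R₀ + 2` lattice units above the window or below it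
(`R₀ = timeRadius r.curvature`), with window and plane inside the central eighth of the torus, the reflected self-pairing of the lattice
observable is bounded polynomially in the plane position: `‖∫ obsOf Φ' · conj (obsOf Φ' ∘ planeRefl T) dμ_k‖ ≤ C (1 + |a_k T|)^κ |Φ'|²_{s''}`. -/
def VarBound (r : LatticeRep G) (sch : SpeciesScheme (YMSpecies G)) : Prop :=
  ∀ p : ℕ, ∃ (s'' κ : ℕ) (C : ℝ), 0 ≤ C ∧ ∀ᶠ k in atTop, ∀ (Φ' : 𝓢((Fin p → 𝔼), ℂ)) (T : ℤ) (θlo θhi : ℝ),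
    AvoidsLocus Φ' → tsupport (Φ' : (Fin p → 𝔼) → ℂ) ⊆ {x | ∀ j, θlo ≤ x j 0 ∧ x j 0 ≤ θhi} →
    (⌊θhi / sch.a k⌋ + (timeRadius r.curvature : ℤ) + 2 ≤ T ∨ T ≤ ⌈θlo / sch.a k⌉ - (timeRadius r.curvature : ℤ) - 2) →
    |θlo| ≤ sch.a k * sch.L k / 8 → |θhi| ≤ sch.a k * sch.L k / 8 → |sch.a k * T| ≤ sch.a k * sch.L k / 8 →
      ‖∫ U, obsOf r sch k p Φ' U * conj (obsOf r sch k p Φ' (planeRefl sch k T U)) ∂(μW r sch k)‖ ≤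
        C * (1 + |sch.a k * T|) ^ κ * (schwartzNorm s'' Φ') ^ 2

/-- **The far-window radius** `ρ_k = √(a_k L_k)`: tends to infinity and is eventually `≤ a_k L_k / 16`; under `PolyVolumeGrowth` it dominates
a positive power of `a_k⁻¹`, which is what makes the sup-norm tail bounds (`a_k^{-4p} ρ_k^{-N}`) go to zero. -/
def rhoK {ι : Type} (sch : SpeciesScheme ι) (k : ℕ) : ℝ := Real.sqrt (sch.a k * sch.L k)

section Pieces

variable {p : ℕ}

/-- Window of the LOWER factor: times in `[−ρ, s₀/4]` (up to the unit transition layers of the cutoffs). -/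
def lowMain (ρ s₀ : ℝ) (X : 𝓢((Fin p → 𝔼), ℂ)) : 𝓢((Fin p → 𝔼), ℂ) := cutGE 0 (-ρ) (cutLE 0 (s₀ / 4) X)
/-- Mid tail of the LOWER factor: some point above `s₀/4`, all points above `−ρ`. -/
def lowMid (ρ s₀ : ℝ) (X : 𝓢((Fin p → 𝔼), ℂ)) : 𝓢((Fin p → 𝔼), ℂ) := cutGE 0 (-ρ) (X - cutLE 0 (s₀ / 4) X)
/-- Far tail of the LOWER factor: some point below `−ρ`. -/
def lowFar (ρ : ℝ) (X : 𝓢((Fin p → 𝔼), ℂ)) : 𝓢((Fin p → 𝔼), ℂ) := X - cutGE 0 (-ρ) X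
/-- Window of the (already translated) UPPER factor: times in `[3s₀/4, s₀ + ρ]`. -/
def upMain (ρ s₀ : ℝ) (Y : 𝓢((Fin p → 𝔼), ℂ)) : 𝓢((Fin p → 𝔼), ℂ) := cutLE 0 (s₀ + ρ) (cutGE 0 (3 * s₀ / 4) Y)
/-- Mid tail of the UPPER factor: some point below `3s₀/4`, all points below `s₀ + ρ`. -/
def upMid (ρ s₀ : ℝ) (Y : 𝓢((Fin p → 𝔼), ℂ)) : 𝓢((Fin p → 𝔼), ℂ) := cutLE 0 (s₀ + ρ) (Y - cutGE 0 (3 * s₀ / 4) Y)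
/-- Far tail of the UPPER factor: some point above `s₀ + ρ`. -/
def upFar (ρ s₀ : ℝ) (Y : 𝓢((Fin p → 𝔼), ℂ)) : 𝓢((Fin p → 𝔼), ℂ) := Y - cutLE 0 (s₀ + ρ) Y

/-- The three pieces of the lower factor add up. -/
theorem lowMain_add_lowMid_add_lowFar (ρ s₀ : ℝ) (X : 𝓢((Fin p → 𝔼), ℂ)) : lowMain ρ s₀ X + lowMid ρ s₀ X + lowFar ρ X = X := by
  simp only [lowMain, lowMid, lowFar, map_sub]; abel

/-- The three pieces of the upper factor add up. -/
theorem upMain_add_upMid_add_upFar (ρ s₀ : ℝ) (Y : 𝓢((Fin p → 𝔼), ℂ)) : upMain ρ s₀ Y + upMid ρ s₀ Y + upFar ρ s₀ Y = Y := by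
  simp only [upMain, upMid, upFar, map_sub]; abel

end Pieces

/-- **The core clustering estimate** (assembled in `…UclCore` from the main-term and tail bounds): for locus-avoiding `Low` (`n₁` points) and
`Up` (`n₂` points) whose supports are separated by the values of a SPATIAL coordinate `crd` (any predicate), and a translation vector `b` with
`0 < b 0` and `b crd = 0`: for every `ε > 0` there is `t₀` such that for all `t ≥ t₀`, eventually in `k`,
`‖cD (Low ⊗ T_{tb} Up) − cD Low · cD (T_{tb} Up)‖ ≤ ε`. -/
def CoreClustering (r : LatticeRep G) (sch : SpeciesScheme (YMSpecies G)) : Prop :=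
  ∀ (n₁ n₂ : ℕ) (Low : 𝓢((Fin n₁ → 𝔼), ℂ)) (Up : 𝓢((Fin n₂ → 𝔼), ℂ)), AvoidsLocus Low → AvoidsLocus Up →
    ∀ (crd : Fin 4), crd ≠ 0 → ∀ (P : ℝ → Prop),
      tsupport (Low : (Fin n₁ → 𝔼) → ℂ) ⊆ {x | ∀ j, P (x j crd)} →
      tsupport (Up : (Fin n₂ → 𝔼) → ℂ) ⊆ {y | ∀ j, ¬ P (y j crd)} →
      ∀ b : 𝔼, 0 < b 0 → b crd = 0 → ∀ ε : ℝ, 0 < ε → ∃ t₀ : ℝ, ∀ t : ℝ, t₀ ≤ t → ∀ᶠ k in atTop,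
        ‖curvDistribution r sch k (n₁ + n₂) (Low.appendTensor (translateMulti (t • b) Up)) -
            curvDistribution r sch k n₁ Low * curvDistribution r sch k n₂ (translateMulti (t • b) Up)‖ ≤ ε

/-- The far radius tends to infinity (registered glue). -/
theorem tendsto_rhoK_atTop : ∀ {ι : Type} (sch : SpeciesScheme ι), Tendsto (rhoK sch) atTop atTop := by
  intro ι sch
  exact Real.tendsto_sqrt_atTop.comp sch.tendsto_L

end Summit.QuantumFields.YangMills.Cruxes.ContinuumLimitOnTrajectory.TwoOrbitSynchronisation

end
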